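import Summits.AnomalousDissipation.AnomalousDissipation.Theses.HopfSnake

/-!
# Route HopfSnake — Assembly (item stmt-AnomalousDissipation-10641)

`Assembly : BoundedSnakeToZero3D → BoundedSnakesAreLoud3D → AnomalousDissipation`.

Pure logic: take the genuinely three-dimensional force `f` and its bounded (d)-snake `(ν, u, p)`
with energy bound from `BoundedSnakeToZero3D`, instantiate the universal loudness crux
`BoundedSnakesAreLoud3D` at `(f, ν, u, p)` to get `ε > 0` with mean dissipation `≥ ε` at
arbitrarily small `ν s`, repackage as the target `BoundedLoudSnake` (forgetting the 3-D side
condition), and apply the route's certified deciding theorem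
`closes : BoundedLoudSnake → AnomalousDissipation`.
-/

-- `Summit.<Summit>.<Problem>` is the tree's mandated summit-side namespace (CONVENTIONS §2); for this
-- single-conjunct summit the two coincide, so the duplicate is deliberate.
set_option linter.dupNamespace false

namespace Summit.AnomalousDissipation.AnomalousDissipation.Theorems

open Summit.AnomalousDissipation.AnomalousDissipation.Theses.HopfSnake

/-- **Assembly of route HopfSnake** (item stmt-AnomalousDissipation-10641):
`BoundedSnakeToZero3D → BoundedSnakesAreLoud3D → AnomalousDissipation`.
Instantiate the loudness crux on the bounded (d)-snake of a genuinely three-dimensional force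
to obtain `BoundedLoudSnake`, then apply the route's deciding theorem `closes`. -/
theorem hopfSnakeAssembly_proof :
    Summit.AnomalousDissipation.AnomalousDissipation.Theses.HopfSnake.Assembly := by
  unfold Summit.AnomalousDissipation.AnomalousDissipation.Theses.HopfSnake.Assembly
  rintro ⟨f, hf, hdiv, hmean, h3d, ν, u, p, hsnake, hE⟩ hloud
  exact closes ⟨f, hf, hdiv, hmean, ν, u, p, hsnake, hE,
    hloud f hf hdiv hmean h3d ν u p hsnake hE⟩

end Summit.AnomalousDissipation.AnomalousDissipation.Theorems
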